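import Summits.QuantumFields.YangMills.Theorems.BalabanUVNodesN15TwoGridDressedDivergenceDefect
import Summits.QuantumFields.YangMills.Theorems.BalabanUVNodesN15TwoGridDressedDivergenceJunk
import Summits.QuantumFields.YangMills.Theorems.BalabanUVNodesN15TwoGridFirstOrderSupCarrier
import HarnessLib

/-!
# N15 (NE2) — PROGRAMME D, part D-E: ★★★ THE η-DEFECT OF THE DRESSED SOURCE DIVERGENCE `X∘∇*_κ` OF BAŁABAN's PAIR `(Δ′_a⁻¹, Δ_a⁻¹)`, SUP-BLOCK CURRENCY, HYPOTHESIS-FREE UNDER THE (3.35)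
# PAIR ALONE: `≤ B·(L^k)^{−γ₀}·e^{−δd}`, `γ₀ = min(1∕16, 1∕(8(d+1)))`
Seat `pub-ymgap-dag-n15-a` g26; `--kind proof --supports stmt-QuantumFields-27366 --as helper` (K3⁸; count-neutral); 0 def.  Over D-B (★★★ `hasMaj_idef_dressedDiv_of_letters`), D-C (`hasMaj_dressedDiv`,
`hasMaj_fstep_dressedDiv`, `pull_bshift_sub_id_comp_eq`), D-D (★★ `hasMaj_junk_bRow`), part 3 (`ineq110_114_pair`, `hasMaj_gOp_of_ineq`, `hasMaj_grad_of_ineq`, `hasMaj_gDivAdj_of_ineq`), N-IIn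
(`hasMaj_gGrad_of_ineq`), part 52 (`hasMaj_twoGridDefect`), part 71 (`hasMaj_twoGridDefect_div`), n15-c W (`hasMaj_oneStepFwd_gDivAdj`, `symbOp_sTinv_sub_one_eq`), M-C
(`hasMaj_comp_idef_mulOp_blockAvg_of_divAdj`), n15-b g4 (`fibreOsc_of_fgrad`, `abs_fgrad_blockAvg_le`, `fit_blockAvg`, `abs_blockAvg_le`) BY NAME; nothing in the tree is modified.
WHAT.  HANDOFF §g25.6 (t3) «the dressed DIVERGENCE entry of the pair of record» — D-B fired on the torus family of record with EVERY letter a tree theorem: §25 `dressedDiv_const_bound` (arithmetic),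
§26 ★★★ `hasMaj_idef_dressedDiv_gOp`: for odd `L ≥ 3`, `a > 0` there are `δ, r₀, B > 0` such that for every `m_T`, `k ≥ 1`, `m`, direction `κ` and fine first-order coefficients `(c′, a′_μ)` with the
(3.35) PAIR `|c′|, |a′_μ| ≤ r`, `|∇′_{κ′}a′_μ| ≤ r` (all directions), `r ≤ r₀`: `𝔇_{kingPrV}(X′∘∇′*_κ, X̄∘∇̄*_κ) ≤ B·(L^k)^{−γ₀}·e^{−δ|y−y′|_T}` (`X′, X̄` the dressed propagators of n15-b's
species at `(Δ′_a⁻¹, Δ_a⁻¹)`, coarse partner `blockAvg`).  Rates of the letters: 𝔇(G) `(L^k)^{−1∕16}`, 𝔇(G∇*) `(L^k)^{−1∕(8(d+1))}`, one-step of «G∇*» `(L^k)^{−1∕2}`, M-C and the a-fit `L^{−k}` —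
all absorbed into `θ = (L^k)^{−γ₀}`.  [cite: Balaban1985BackgroundPropagators, (3.35) p.396, (3.42) p.397, (3.52) p.400, (3.62)–(3.65) pp.402–403; Balaban1984PropagatorsI, Prop. 1.2 pp.35–36]
HONEST FRAMING ∕ LIMITS.  `U ≡ 1` Landau-gauge pair on the torus family of record, NOT Bałaban's `G(U)` for general `U`; ABELIANISED scalar-multiplier model of (3.52)'s `V′(A)`; (C3) block-average
transport; flat `∇*_κ` (the covariant `D*_{U′}` differs by diagonal∕shift dressings — located); the exponent is a currency artefact; NE2⁺ as printed NOT PRINTED ∕ NOT proved; no statement of record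
touched; N15 NOT discharged; K3⁸ OPEN; counts UNMOVED (typed 28∕28 · discharged 5∕27); finite tori — NOT ℝ⁴ ∕ OS ∕ mass gap ∕ Clay.  ONE declared `set_option maxHeartbeats 4000000 in` on ★★★.
-/


noncomputable section

open scoped BigOperators
open Finset

namespace Summit.QuantumFields.YangMills.BalabanUVNodes.N15.TwoGrid

open Literature.MathematicalPhysics.QuantumFieldTheory.Balaban1983to89
open Literature.MathematicalPhysics.QuantumFieldTheory.Balaban1983to89.B11SectG (BlockNorm HasMaj)
open Literature.MathematicalPhysics.QuantumFieldTheory.Balaban1983to89.T4EtaRateDefect (idef)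
open Literature.MathematicalPhysics.QuantumFieldTheory.Balaban1983to89.T4EtaRateCoeffDefect (pull blockAvg fit_blockAvg)
open Literature.MathematicalPhysics.QuantumFieldTheory.Balaban1983to89.B6Prop26Gluing (mulOp)
open Literature.MathematicalPhysics.QuantumFieldTheory.Balaban1983to89.B5Prop11Plancherel (Tor fine unitVec)
open Literature.MathematicalPhysics.QuantumFieldTheory.Balaban1983to89.B5SiteBridgeP12 (MP)
open Literature.MathematicalPhysics.QuantumFieldTheory.King1986.Torus (blockOf tdistT tdistT_nonneg)
open Literature.MathematicalPhysics.QuantumFieldTheory.Balaban1983to89.B6UnitTorusCarrier (unitTorusGeo rowSum_unitTorusGeo)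
open Summit.QuantumFields.YangMills.BalabanUVNodes.N15.VectorPiece (blkFine kingPrV bshiftEquiv bshiftEquiv_apply bshiftEquiv_symm_apply blkFine_comp_kingPrV)
open Summit.QuantumFields.YangMills.BalabanUVNodes.N15.BackgroundLayer (bgPair projO fgrad fgrad_apply abs_blockAvg_le fibreOsc_of_fgrad abs_fgrad_blockAvg_le hasMaj_oneStepFwd_gDivAdj
  symbOp_sTinv_sub_one_eq)

variable (d : ℕ) {L : ℕ} [NeZero L]

/-! ## §25 Arithmetic of the constants -/

/-- the final constant bookkeeping: every summand of D-B's `A` carries `θ`, and `(1 − q′)⁻¹ ≤ 2`. [folklore] -/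
theorem dressedDiv_const_bound {D₁ D₂ C cr Kc Kb KH θ r oa E t q₂ : ℝ} (hD₁ : 0 ≤ D₁) (hD₂ : 0 ≤ D₂) (hC : 0 ≤ C) (hcr : 0 ≤ cr) (hKc : 0 ≤ Kc) (hKb : 0 ≤ Kb)
    (hKH : 0 ≤ KH) (hθ : 0 ≤ θ) (hr : 0 ≤ r) (hr1 : r ≤ 1) (hoa : 0 ≤ oa) (hoaθ : oa ≤ 2 * (t + 1) * θ) (hE : 0 ≤ E) (ht : 0 ≤ t) (hq₂ : 0 ≤ q₂) (hq₂2 : q₂ ≤ 2) :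
    (D₂ * θ + D₁ * θ * ((r + (t + 1) * r) * (2 * C)) * cr + Kc * θ * (2 * C) * cr + (t + 1) * (Kb * θ) +
        (t + 1) * (D₂ * θ * (r * (2 * C * E)) * cr + C * oa * (2 * C * E) * cr + C * r * (KH * θ) * cr)) * q₂ ≤
      (2 * (D₂ + D₁ * ((t + 2) * (2 * C)) * cr + Kc * (2 * C) * cr + (t + 1) * Kb + (t + 1) * (D₂ * (2 * C * E) * cr + C * (2 * (t + 1)) * (2 * C * E) * cr + C * KH * cr)) + 1) * θ := by
  have s1 : D₁ * θ * ((r + (t + 1) * r) * (2 * C)) * cr ≤ D₁ * ((t + 2) * (2 * C)) * cr * θ := by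
    have h0 : r + (t + 1) * r ≤ t + 2 := by nlinarith
    have h : (r + (t + 1) * r) * (2 * C) ≤ (t + 2) * (2 * C) := mul_le_mul_of_nonneg_right h0 (by positivity)
    calc D₁ * θ * ((r + (t + 1) * r) * (2 * C)) * cr = (D₁ * θ * cr) * ((r + (t + 1) * r) * (2 * C)) := by ring
      _ ≤ (D₁ * θ * cr) * ((t + 2) * (2 * C)) := mul_le_mul_of_nonneg_left h (by positivity)
      _ = D₁ * ((t + 2) * (2 * C)) * cr * θ := by ring
  have s2 : D₂ * θ * (r * (2 * C * E)) * cr ≤ D₂ * (2 * C * E) * cr * θ := by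
    have h : r * (2 * C * E) ≤ 1 * (2 * C * E) := mul_le_mul_of_nonneg_right hr1 (by positivity)
    calc D₂ * θ * (r * (2 * C * E)) * cr = (D₂ * θ * cr) * (r * (2 * C * E)) := by ring
      _ ≤ (D₂ * θ * cr) * (1 * (2 * C * E)) := mul_le_mul_of_nonneg_left h (by positivity)
      _ = D₂ * (2 * C * E) * cr * θ := by ring
  have s3 : C * oa * (2 * C * E) * cr ≤ C * (2 * (t + 1)) * (2 * C * E) * cr * θ := by
    calc C * oa * (2 * C * E) * cr = (C * (2 * C * E) * cr) * oa := by ring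
      _ ≤ (C * (2 * C * E) * cr) * (2 * (t + 1) * θ) := mul_le_mul_of_nonneg_left hoaθ (by positivity)
      _ = C * (2 * (t + 1)) * (2 * C * E) * cr * θ := by ring
  have s4 : C * r * (KH * θ) * cr ≤ C * KH * cr * θ := by
    calc C * r * (KH * θ) * cr = (C * KH * cr * θ) * r := by ring
      _ ≤ (C * KH * cr * θ) * 1 := mul_le_mul_of_nonneg_left hr1 (by positivity)
      _ = C * KH * cr * θ := by ring
  set A₀ : ℝ := D₂ + D₁ * ((t + 2) * (2 * C)) * cr + Kc * (2 * C) * cr + (t + 1) * Kb + (t + 1) * (D₂ * (2 * C * E) * cr + C * (2 * (t + 1)) * (2 * C * E) * cr + C * KH * cr)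
    with hA₀
  have hA₀0 : 0 ≤ A₀ := by positivity
  have hsum : D₂ * θ + D₁ * θ * ((r + (t + 1) * r) * (2 * C)) * cr + Kc * θ * (2 * C) * cr + (t + 1) * (Kb * θ) +
      (t + 1) * (D₂ * θ * (r * (2 * C * E)) * cr + C * oa * (2 * C * E) * cr + C * r * (KH * θ) * cr) ≤ A₀ * θ := by
    have h5 : (t + 1) * (D₂ * θ * (r * (2 * C * E)) * cr + C * oa * (2 * C * E) * cr + C * r * (KH * θ) * cr) ≤
        (t + 1) * ((D₂ * (2 * C * E) * cr + C * (2 * (t + 1)) * (2 * C * E) * cr + C * KH * cr) * θ) :=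
      mul_le_mul_of_nonneg_left (by nlinarith [s2, s3, s4]) (by positivity)
    rw [hA₀]
    nlinarith [s1, h5]
  have hpos : 0 ≤ D₂ * θ + D₁ * θ * ((r + (t + 1) * r) * (2 * C)) * cr + Kc * θ * (2 * C) * cr + (t + 1) * (Kb * θ) +
      (t + 1) * (D₂ * θ * (r * (2 * C * E)) * cr + C * oa * (2 * C * E) * cr + C * r * (KH * θ) * cr) := by positivity
  calc _ ≤ (A₀ * θ) * 2 := mul_le_mul hsum hq₂2 hq₂ (by positivity)
    _ ≤ (2 * A₀ + 1) * θ := by nlinarith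

/-! ## §26 ★★★ D-B on the pair of record, every letter discharged -/

set_option maxHeartbeats 4000000 in
/-- ★★★ **THE η-DEFECT OF THE DRESSED SOURCE DIVERGENCE OF BAŁABAN's PAIR `(Δ′_a⁻¹, Δ_a⁻¹)`, SUP-BLOCK CURRENCY, HYPOTHESIS-FREE, UNDER THE (3.35) PAIR ALONE.**  See the module docstring (WHAT).
[cite: Balaban1985BackgroundPropagators, Thm 3.1 (3.42) p.397 (entry `G(U)∇*`: shape), (3.35) p.396, (3.52) p.400, (3.62)–(3.65) pp.402–403 (mechanism); Balaban1984PropagatorsI, Prop. 1.2 (1.110)–(1.111)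
p.35 (rows and Hölder letters); King1986, p.664 (pairing), Prop. 3.9 (3.73) p.665 (rate factor); Balaban1984PropagatorsII, Lemma 2.1 (2.61) p.234] -/
theorem hasMaj_idef_dressedDiv_gOp (hLodd : Odd L) (hL3 : 3 ≤ L) {a : ℝ} (ha : 0 < a) :
    ∃ δ r₀ B : ℝ, 0 < δ ∧ 0 < r₀ ∧ 0 < B ∧ ∀ (mT k m : ℕ) (hk : 1 ≤ k) (hL : Odd L ∧ 1 < L) (κ : Fin (d + 1)) (r : ℝ) (_hr : 0 ≤ r) (_hr₀ : r ≤ r₀)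
      (c' : Tor (fine (L ^ m * L ^ k) (MP (paramsOf d L mT k hL))) × Fin (d + 1) → ℝ) (a' : Fin (d + 1) → Tor (fine (L ^ m * L ^ k) (MP (paramsOf d L mT k hL))) × Fin (d + 1) → ℝ)
      (_hc' : ∀ z, |c' z| ≤ r) (_ha' : ∀ μ z, |a' μ z| ≤ r)
      (_hga : ∀ μ κ' z, |fgrad ((L ^ m * L ^ k : ℕ) : ℝ) (bshiftEquiv (MP (paramsOf d L mT k hL)) (L ^ m * L ^ k) κ') (a' μ) z| ≤ r),
      HasMaj (BlockNorm.ofBlocks (unitTorusGeo L k (MP (paramsOf d L mT k hL))) (blkFine L k (MP (paramsOf d L mT k hL))))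
        (BlockNorm.ofBlocks (unitTorusGeo L k (MP (paramsOf d L mT k hL)))
          (fun i : Tor (fine (L ^ m * L ^ k) (MP (paramsOf d L mT k hL))) × Fin (d + 1) => blockOf (L ^ m * L ^ k) (MP (paramsOf d L mT k hL)) i.1))
        (idef (pull (kingPrV L k m (MP (paramsOf d L mT k hL)))) (pull (kingPrV L k m (MP (paramsOf d L mT k hL))))
          ((projO none ∘ₗ bgPair (gOp (MP (paramsOf d L mT k hL)) (L ^ m * L ^ k) a)
            (fun μ => symbOp (MP (paramsOf d L mT k hL)) (L ^ m * L ^ k) (sD (MP (paramsOf d L mT k hL)) (L ^ m * L ^ k) μ ((L ^ m * L ^ k : ℕ) : ℝ)) ∘ₗ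
              gOp (MP (paramsOf d L mT k hL)) (L ^ m * L ^ k) a) c' a') ∘ₗ
            symbOp (MP (paramsOf d L mT k hL)) (L ^ m * L ^ k) (((L ^ m * L ^ k : ℕ) : ℝ) • (sTinv (MP (paramsOf d L mT k hL)) (L ^ m * L ^ k) κ - 1)))
          ((projO none ∘ₗ bgPair (gOp (MP (paramsOf d L mT k hL)) (L ^ k) a)
            (fun μ => symbOp (MP (paramsOf d L mT k hL)) (L ^ k) (sD (MP (paramsOf d L mT k hL)) (L ^ k) μ ((L ^ k : ℕ) : ℝ)) ∘ₗ gOp (MP (paramsOf d L mT k hL)) (L ^ k) a)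
            (blockAvg (kingPrV L k m (MP (paramsOf d L mT k hL))) c') (fun μ => blockAvg (kingPrV L k m (MP (paramsOf d L mT k hL))) (a' μ))) ∘ₗ
            symbOp (MP (paramsOf d L mT k hL)) (L ^ k) (((L ^ k : ℕ) : ℝ) • (sTinv (MP (paramsOf d L mT k hL)) (L ^ k) κ - 1))))
        (fun y y' => B * ((L ^ k : ℕ) : ℝ) ^ (-(min (1 / 16 : ℝ) (1 / (8 * ((d : ℝ) + 1))))) * Real.exp (-(δ * tdistT (MP (paramsOf d L mT k hL)) y y'))) := by
  have hL2 : 2 ≤ L := by omega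
  have hL : Odd L ∧ 1 < L := ⟨hLodd, by omega⟩
  obtain ⟨δ₀, C, Cα, Cε, Cαε, hδ₀, hC, H110⟩ := ineq110_114_pair (d := d) hL ha
  obtain ⟨δ₁, D₁, hδ₁, hD₁, HDef⟩ := hasMaj_twoGridDefect (d := d) hLodd hL2 ha (γ := 1 / 8) (by norm_num) (by norm_num)
  obtain ⟨δ₂, D₂, hδ₂, hD₂, HDiv⟩ := hasMaj_twoGridDefect_div (d := d) hLodd hL2 ha
  obtain ⟨δ₃, C₆, hδ₃, hC₆, HStep⟩ := hasMaj_oneStepFwd_gDivAdj (d := d) hLodd hL2 ha (α := 1 / 2) (by norm_num) (by norm_num)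
  set δm : ℝ := min (min δ₀ δ₁) (min δ₂ δ₃) with hδm_def
  have hδm : 0 < δm := lt_min (lt_min hδ₀ hδ₁) (lt_min hδ₂ hδ₃)
  have eδ₀ : δm ≤ δ₀ := (min_le_left _ _).trans (min_le_left _ _)
  have eδ₁ : δm ≤ δ₁ := (min_le_left _ _).trans (min_le_right _ _)
  have eδ₂ : δm ≤ δ₂ := (min_le_right _ _).trans (min_le_left _ _)
  have eδ₃ : δm ≤ δ₃ := (min_le_right _ _).trans (min_le_right _ _)
  set σ : ℝ := δm / 8 with hσ_def
  have hσ : 0 < σ := by positivity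
  set ρY : ℝ := 7 * δm / 8 with hρY_def
  set ρ : ℝ := 6 * δm / 8 with hρ_def
  obtain ⟨hρY, hρ⟩ : 0 < ρY ∧ 0 < ρ := ⟨by positivity, by positivity⟩
  have hρYδ : ρY + σ ≤ δm := by rw [hρY_def, hσ_def]; linarith
  have hρρY : ρ + σ ≤ ρY := by rw [hρ_def, hρY_def, hσ_def]; linarith
  obtain ⟨hρδ, hρle⟩ : ρ + σ ≤ δm ∧ ρ ≤ ρY := ⟨by linarith, by linarith⟩
  set cr : ℝ := B4Sect5Proof.latticeConst (d + 1) σ with hcr_def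
  have hcr : 0 ≤ cr := B4Sect5Proof.latticeConst_nonneg (d + 1) hσ.le
  set C₂ : ℝ := 2 * (C * Real.exp δ₀) with hC₂_def
  have hC₂ : 0 ≤ C₂ := by positivity
  set E : ℝ := Real.exp ρY with hE_def
  have hE : 0 ≤ E := (Real.exp_pos _).le
  have hE1 : 1 ≤ E := Real.one_le_exp hρY.le
  obtain ⟨KH, hKH_def⟩ : ∃ KH : ℝ, KH = C₆ + C * (((d : ℝ) + 2) * (2 * C)) * cr + ((d : ℝ) + 1) * (C₆ * (1 * (2 * C * E)) * cr) := ⟨_, rfl⟩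
  have hKH : 0 ≤ KH := by rw [hKH_def]; positivity
  obtain ⟨Kb, hKb_def⟩ : ∃ Kb : ℝ, Kb = (C * 1 * KH + C * (1 * (2 * C * E) * E) + C * (2 * ((d : ℝ) + 1)) * KH + C * (2 * ((d : ℝ) + 1) * (2 * C * E) * E)) * cr := ⟨_, rfl⟩
  have hKb : 0 ≤ Kb := by rw [hKb_def]; positivity
  obtain ⟨Kc, hKc_def⟩ : ∃ Kc : ℝ, Kc = 2 * ((d : ℝ) + 1) * C := ⟨_, rfl⟩
  have hKc : 0 ≤ Kc := by rw [hKc_def]; positivity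
  obtain ⟨W, hW_def⟩ : ∃ W : ℝ, W = (C * ((d : ℝ) + 2) + (C + ((d : ℝ) + 1) * (C₂ + C))) * cr := ⟨_, rfl⟩
  have hW : 0 ≤ W := by rw [hW_def]; positivity
  obtain ⟨r₀, hr₀_def⟩ : ∃ r₀ : ℝ, r₀ = (2 * W + 2)⁻¹ := ⟨_, rfl⟩
  have hr₀ : 0 < r₀ := by rw [hr₀_def]; positivity
  have hr₀1 : r₀ ≤ 1 := by rw [hr₀_def]; exact inv_le_one_of_one_le₀ (by linarith)
  obtain ⟨B, hB_def⟩ : ∃ B : ℝ, B = 2 * (D₂ + D₁ * (((d : ℝ) + 2) * (2 * C)) * cr + Kc * (2 * C) * cr + ((d : ℝ) + 1) * Kb +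
      ((d : ℝ) + 1) * (D₂ * (2 * C * E) * cr + C * (2 * ((d : ℝ) + 1)) * (2 * C * E) * cr + C * KH * cr)) + 1 := ⟨_, rfl⟩
  have hBpos : 0 < B := by rw [hB_def]; positivity
  refine ⟨ρ, r₀, B, hρ, hr₀, hBpos, ?_⟩
  intro mT k m hk hL' κ r hr hrr₀ c' a' hc' ha' hga
  have hr1 : r ≤ 1 := hrr₀.trans hr₀1
  have hLr : (0 : ℝ) < (L : ℝ) := by exact_mod_cast (show 0 < L by omega)
  have hkpos : (0 : ℝ) < ((L ^ k : ℕ) : ℝ) := by positivity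
  have hn : 1 ≤ L ^ k := Nat.one_le_pow _ _ (by omega)
  have hn' : 1 ≤ L ^ m * L ^ k := Nat.one_le_iff_ne_zero.mpr (NeZero.ne _)
  have hnr1 : (1 : ℝ) ≤ ((L ^ k : ℕ) : ℝ) := by exact_mod_cast hn
  have hn'pos : (0 : ℝ) < ((L ^ m * L ^ k : ℕ) : ℝ) := by positivity
  set γ₀ : ℝ := min (1 / 16 : ℝ) (1 / (8 * ((d : ℝ) + 1))) with hγ₀_def
  have hγ₀ : 0 < γ₀ := lt_min (by norm_num) (by positivity)
  obtain ⟨hγ₀a, hγ₀b⟩ : γ₀ ≤ 1 / 16 ∧ γ₀ ≤ 1 / (8 * ((d : ℝ) + 1)) := ⟨min_le_left _ _, min_le_right _ _⟩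
  set θ : ℝ := ((L ^ k : ℕ) : ℝ) ^ (-γ₀) with hθ_def
  have hθ : 0 ≤ θ := Real.rpow_nonneg hkpos.le _
  have habs : ∀ {e : ℝ}, γ₀ ≤ e → ((L ^ k : ℕ) : ℝ) ^ (-e) ≤ θ := fun he => Real.rpow_le_rpow_of_exponent_le hnr1 (by linarith)
  have h16 : ((L ^ k : ℕ) : ℝ) ^ (-((1 / 8 : ℝ) / 2)) ≤ θ := by rw [show (-((1 / 8 : ℝ) / 2)) = -(1 / 16 : ℝ) by norm_num]; exact habs hγ₀a
  have h8 : ((L ^ k : ℕ) : ℝ) ^ (-(1 / (8 * ((d : ℝ) + 1)))) ≤ θ := habs hγ₀b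
  have h2 : ((L ^ k : ℕ) : ℝ) ^ (-(1 / 2 : ℝ)) ≤ θ := habs (by linarith)
  have hinv : (((L ^ k : ℕ) : ℝ))⁻¹ ≤ θ := by rw [← Real.rpow_neg_one]; exact habs (by linarith)
  have hmono : ∀ {F₁ F₂ : Type} [AddCommGroup F₁] [Module ℝ F₁] [AddCommGroup F₂] [Module ℝ F₂]
      {b₁ : BlockNorm (unitTorusGeo L k (MP (paramsOf d L mT k hL'))) F₁} {b₂ : BlockNorm (unitTorusGeo L k (MP (paramsOf d L mT k hL'))) F₂} {T : F₁ →ₗ[ℝ] F₂} {A A' t tt : ℝ},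
      0 ≤ A → A ≤ A' → tt ≤ t → HasMaj b₁ b₂ T (fun y y' => A * Real.exp (-(t * tdistT (MP (paramsOf d L mT k hL')) y y'))) → HasMaj b₁ b₂ T (fun y y' => A' * Real.exp (-(tt * tdistT (MP (paramsOf d L mT k hL')) y y'))) :=
    fun hA hAA' htt h => h.mono fun y y' => mul_le_mul hAA' (Real.exp_le_exp.mpr (by nlinarith [tdistT_nonneg (MP (paramsOf d L mT k hL')) y y'])) (Real.exp_nonneg _) (hA.trans hAA')
  obtain ⟨Hc, Hf⟩ := H110 mT k m hk
  have hG := hmono hC.le le_rfl eδ₀ (hasMaj_gOp_of_ineq (MP (paramsOf d L mT k hL')) k (L ^ k) a hn Hc hC.le)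
  have hGD := fun μ : Fin (d + 1) => hmono hC.le le_rfl eδ₀ (hasMaj_grad_of_ineq (MP (paramsOf d L mT k hL')) k (L ^ k) a hn Hc hC.le μ)
  have hGgrad := fun μ : Fin (d + 1) => hmono hC₂ le_rfl eδ₀ (hasMaj_gGrad_of_ineq (L := L) (k := k) hn Hc hC.le hδ₀.le μ)
  have hGdiv := fun μ : Fin (d + 1) => hmono hC.le le_rfl eδ₀ (hasMaj_gDivAdj_of_ineq (MP (paramsOf d L mT k hL')) k (L ^ k) a hn Hc hC.le μ)
  have hG' := hmono hC.le le_rfl eδ₀ (hasMaj_gOp_of_ineq (MP (paramsOf d L mT k hL')) k (L ^ m * L ^ k) a hn' Hf hC.le)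
  have hG'D := fun μ : Fin (d + 1) => hmono hC.le le_rfl eδ₀ (hasMaj_grad_of_ineq (MP (paramsOf d L mT k hL')) k (L ^ m * L ^ k) a hn' Hf hC.le μ)
  have hG'grad := fun μ : Fin (d + 1) => hmono hC₂ le_rfl eδ₀ (hasMaj_gGrad_of_ineq (L := L) (k := k) hn' Hf hC.le hδ₀.le μ)
  have hG'div := fun μ : Fin (d + 1) => hmono hC.le le_rfl eδ₀ (hasMaj_gDivAdj_of_ineq (MP (paramsOf d L mT k hL')) k (L ^ m * L ^ k) a hn' Hf hC.le μ)
  have hDG := hmono (A := D₁ * ((L ^ k : ℕ) : ℝ) ^ (-((1 / 8 : ℝ) / 2))) (A' := D₁ * θ) (by positivity) (mul_le_mul_of_nonneg_left h16 hD₁.le) eδ₁ (HDef mT k m hk hL')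
  have hDS := fun μ : Fin (d + 1) => hmono (A := D₂ * ((L ^ k : ℕ) : ℝ) ^ (-(1 / (8 * ((d : ℝ) + 1))))) (A' := D₂ * θ) (by positivity)
    (mul_le_mul_of_nonneg_left h8 hD₂.le) eδ₂ (HDiv mT k m hk hL' μ)
  have hSstep : ∀ ι μ : Fin (d + 1), HasMaj (BlockNorm.ofBlocks (unitTorusGeo L k (MP (paramsOf d L mT k hL'))) (fun i : Tor (fine (L ^ k) (MP (paramsOf d L mT k hL'))) × Fin (d + 1) => blockOf (L ^ k) (MP (paramsOf d L mT k hL')) i.1))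
      (BlockNorm.ofBlocks (unitTorusGeo L k (MP (paramsOf d L mT k hL'))) (fun i : Tor (fine (L ^ k) (MP (paramsOf d L mT k hL'))) × Fin (d + 1) => blockOf (L ^ k) (MP (paramsOf d L mT k hL')) i.1))
      ((pull ⇑(bshiftEquiv (MP (paramsOf d L mT k hL')) (L ^ k) ι) - LinearMap.id) ∘ₗ (gOp (MP (paramsOf d L mT k hL')) (L ^ k) a ∘ₗ symbOp (MP (paramsOf d L mT k hL')) (L ^ k) (((L ^ k : ℕ) : ℝ) • (sTinv (MP (paramsOf d L mT k hL')) (L ^ k) μ - 1))))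
      (fun y y' => C₆ * θ * Real.exp (-(δm * tdistT (MP (paramsOf d L mT k hL')) y y'))) := by
    intro ι μ
    have h := HStep mT k m hk hL' ι μ
    rw [← symbOp_sTinv_sub_one_eq] at h
    exact hmono (A := C₆ * ((L ^ k : ℕ) : ℝ) ^ (-(1 / 2 : ℝ))) (by positivity) (mul_le_mul_of_nonneg_left h2 hC₆.le) eδ₃ h
  have hb' : ∀ (μ) (z : Tor (fine (L ^ m * L ^ k) (MP (paramsOf d L mT k hL'))) × Fin (d + 1)),
      |((L ^ m * L ^ k : ℕ) : ℝ) * (a' μ z - a' μ (z.1 - unitVec (fine (L ^ m * L ^ k) (MP (paramsOf d L mT k hL'))) μ, z.2))| ≤ r := by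
    intro μ z
    have h := hga μ μ ((bshiftEquiv (MP (paramsOf d L mT k hL')) (L ^ m * L ^ k) μ).symm z)
    rw [fgrad_apply, Equiv.apply_symm_apply, bshiftEquiv_symm_apply] at h
    exact h
  have hbq : ∀ (μ) (z : Tor (fine (L ^ k) (MP (paramsOf d L mT k hL'))) × Fin (d + 1)), |((L ^ k : ℕ) : ℝ) * (blockAvg (kingPrV L k m (MP (paramsOf d L mT k hL'))) (a' μ) z -
      blockAvg (kingPrV L k m (MP (paramsOf d L mT k hL'))) (a' μ) (z.1 - unitVec (fine (L ^ k) (MP (paramsOf d L mT k hL'))) μ, z.2))| ≤ r := by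
    intro μ z
    have h := abs_fgrad_blockAvg_le (L := L) (k := k) (m := m) (M := (MP (paramsOf d L mT k hL'))) hr μ (fun z => hga μ μ z) ((bshiftEquiv (MP (paramsOf d L mT k hL')) (L ^ k) μ).symm z)
    rw [fgrad_apply, Equiv.apply_symm_apply, bshiftEquiv_symm_apply] at h
    exact h
  set OA : ℝ := ((2 * ((d + 1) * (L ^ m - 1)) : ℕ) : ℝ) * (r / ((L ^ m * L ^ k : ℕ) : ℝ)) with hOA_def
  have hoadef : 0 ≤ OA := by positivity
  set eρ : ℝ := Real.exp ρ with heρ_def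
  have hfa : ∀ μ z, |a' μ z - blockAvg (kingPrV L k m (MP (paramsOf d L mT k hL'))) (a' μ) (kingPrV L k m (MP (paramsOf d L mT k hL')) z)| ≤ ((2 * ((d + 1) * (L ^ m - 1)) : ℕ) : ℝ) * (r / ((L ^ m * L ^ k : ℕ) : ℝ)) :=
    fun μ z => fit_blockAvg _ (fibreOsc_of_fgrad L k m (MP (paramsOf d L mT k hL')) hn'pos fun κ' z => hga μ κ' z) z
  have hcastn : ((L ^ m * L ^ k : ℕ) : ℝ) = ((L ^ m : ℕ) : ℝ) * ((L ^ k : ℕ) : ℝ) := by push_cast; ring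
  have hRm1 : ((2 * ((d + 1) * (L ^ m - 1)) : ℕ) : ℝ) ≤ 2 * ((d : ℝ) + 1) * ((L ^ m : ℕ) : ℝ) := by
    have h1 : ((L ^ m - 1 : ℕ) : ℝ) ≤ ((L ^ m : ℕ) : ℝ) := by exact_mod_cast Nat.sub_le _ _
    have h2' : ((2 * ((d + 1) * (L ^ m - 1)) : ℕ) : ℝ) = 2 * (((d : ℝ) + 1) * ((L ^ m - 1 : ℕ) : ℝ)) := by push_cast; ring
    rw [h2']
    have hd1 : (0 : ℝ) ≤ (d : ℝ) + 1 := by positivity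
    have h3 : ((d : ℝ) + 1) * ((L ^ m - 1 : ℕ) : ℝ) ≤ ((d : ℝ) + 1) * ((L ^ m : ℕ) : ℝ) := mul_le_mul_of_nonneg_left h1 hd1
    linarith
  have hRpos : (0 : ℝ) < ((L ^ m : ℕ) : ℝ) := by positivity
  have hoan : ((2 * ((d + 1) * (L ^ m - 1)) : ℕ) : ℝ) * (r / ((L ^ m * L ^ k : ℕ) : ℝ)) * ((L ^ k : ℕ) : ℝ) ≤ 2 * ((d : ℝ) + 1) * r := by
    rw [hcastn]
    have h : ((2 * ((d + 1) * (L ^ m - 1)) : ℕ) : ℝ) * (r / (((L ^ m : ℕ) : ℝ) * ((L ^ k : ℕ) : ℝ))) * ((L ^ k : ℕ) : ℝ) =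
        ((2 * ((d + 1) * (L ^ m - 1)) : ℕ) : ℝ) / ((L ^ m : ℕ) : ℝ) * r := by field_simp
    rw [h]
    have h2' : ((2 * ((d + 1) * (L ^ m - 1)) : ℕ) : ℝ) / ((L ^ m : ℕ) : ℝ) ≤ 2 * ((d : ℝ) + 1) := by rw [div_le_iff₀ hRpos]; exact hRm1
    exact mul_le_mul_of_nonneg_right h2' hr
  have hoaθ : ((2 * ((d + 1) * (L ^ m - 1)) : ℕ) : ℝ) * (r / ((L ^ m * L ^ k : ℕ) : ℝ)) ≤ 2 * ((d : ℝ) + 1) * θ := by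
    have h1 : ((2 * ((d + 1) * (L ^ m - 1)) : ℕ) : ℝ) * (r / ((L ^ m * L ^ k : ℕ) : ℝ)) ≤ 2 * ((d : ℝ) + 1) * r * (((L ^ k : ℕ) : ℝ))⁻¹ := by
      rw [← div_eq_mul_inv, le_div_iff₀ hkpos]; exact hoan
    have h2' : 2 * ((d : ℝ) + 1) * r * (((L ^ k : ℕ) : ℝ))⁻¹ ≤ 2 * ((d : ℝ) + 1) * 1 * θ :=
      mul_le_mul (mul_le_mul_of_nonneg_left hr1 (by positivity)) hinv (by positivity) (by positivity)
    linarith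
  have hcb : ∀ x, |blockAvg (kingPrV L k m (MP (paramsOf d L mT k hL'))) c' x| ≤ r := abs_blockAvg_le (kingPrV L k m (MP (paramsOf d L mT k hL'))) hr hc'
  have hab : ∀ μ x, |blockAvg (kingPrV L k m (MP (paramsOf d L mT k hL'))) (a' μ) x| ≤ r := fun μ => abs_blockAvg_le (kingPrV L k m (MP (paramsOf d L mT k hL'))) hr (ha' μ)
  have h1 : r₀ * (2 * W + 2) = 1 := by rw [hr₀_def]; exact inv_mul_cancel₀ (by positivity)
  have hr₀W : r₀ * W ≤ 1 / 2 := by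
    have h1' : 2 * (r₀ * W) + 2 * r₀ = 1 := by rw [← h1]; ring
    linarith [hr₀.le]
  have hXnn : 0 ≤ (C + ((d : ℝ) + 1) * (C₂ + C)) * cr := by positivity
  have hYnn : 0 ≤ C * ((d : ℝ) + 2) * cr := by positivity
  have hW1 : C * ((d : ℝ) + 2) * cr ≤ W := by rw [hW_def, add_mul]; linarith
  have hW2 : (C + ((d : ℝ) + 1) * (C₂ + C)) * cr ≤ W := by rw [hW_def, add_mul]; linarith
  have hqle : C * (r * ((d : ℝ) + 2)) * cr ≤ r₀ * W := by
    calc C * (r * ((d : ℝ) + 2)) * cr = r * (C * ((d : ℝ) + 2) * cr) := by ring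
      _ ≤ r₀ * (C * ((d : ℝ) + 2) * cr) := mul_le_mul_of_nonneg_right hrr₀ (by positivity)
      _ ≤ r₀ * W := mul_le_mul_of_nonneg_left hW1 hr₀.le
  have hqKle : (C * r + ((d : ℝ) + 1) * (C₂ * r + C * r)) * cr ≤ r₀ * W := by
    calc (C * r + ((d : ℝ) + 1) * (C₂ * r + C * r)) * cr = r * ((C + ((d : ℝ) + 1) * (C₂ + C)) * cr) := by ring
      _ ≤ r₀ * ((C + ((d : ℝ) + 1) * (C₂ + C)) * cr) := mul_le_mul_of_nonneg_right hrr₀ (by positivity)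
      _ ≤ r₀ * W := mul_le_mul_of_nonneg_left hW2 hr₀.le
  have hq : C * (r * ((d : ℝ) + 2)) * cr < 1 := by linarith
  have hqK : (C * r + ((d : ℝ) + 1) * (C₂ * r + C * r)) * cr < 1 := by linarith
  have hq₂0 : 0 ≤ (1 - (C * r + ((d : ℝ) + 1) * (C₂ * r + C * r)) * cr)⁻¹ := inv_nonneg.mpr (by linarith)
  have hq₂2 : (1 - (C * r + ((d : ℝ) + 1) * (C₂ * r + C * r)) * cr)⁻¹ ≤ 2 := by
    calc (1 - (C * r + ((d : ℝ) + 1) * (C₂ * r + C * r)) * cr)⁻¹ ≤ (1 / 2)⁻¹ := inv_anti₀ (by norm_num) (by linarith)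
      _ = 2 := by norm_num
  have hrow := rowSum_unitTorusGeo L k (MP (paramsOf d L mT k hL')) hσ
  set Yc := ((projO none ∘ₗ bgPair (gOp (MP (paramsOf d L mT k hL')) (L ^ k) a) (fun μ => symbOp (MP (paramsOf d L mT k hL')) (L ^ k) (sD (MP (paramsOf d L mT k hL')) (L ^ k) μ ((L ^ k : ℕ) : ℝ)) ∘ₗ gOp (MP (paramsOf d L mT k hL')) (L ^ k) a) (blockAvg (kingPrV L k m (MP (paramsOf d L mT k hL'))) c')
          (fun μ => blockAvg (kingPrV L k m (MP (paramsOf d L mT k hL'))) (a' μ))) ∘ₗ symbOp (MP (paramsOf d L mT k hL')) (L ^ k) (((L ^ k : ℕ) : ℝ) • (sTinv (MP (paramsOf d L mT k hL')) (L ^ k) κ - 1))) with hYc_def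
  have hY0 := hasMaj_dressedDiv (MP (paramsOf d L mT k hL')) k (L ^ k) hσ.le hrow hρY.le hρYδ hC.le hC.le hC₂ hr hr κ hG hGD hGgrad (hGdiv κ) hcb hab hbq hq hqK
  have hY : HasMaj (BlockNorm.ofBlocks (unitTorusGeo L k (MP (paramsOf d L mT k hL'))) (fun i : Tor (fine (L ^ k) (MP (paramsOf d L mT k hL'))) × Fin (d + 1) => blockOf (L ^ k) (MP (paramsOf d L mT k hL')) i.1))
      (BlockNorm.ofBlocks (unitTorusGeo L k (MP (paramsOf d L mT k hL'))) (fun i : Tor (fine (L ^ k) (MP (paramsOf d L mT k hL'))) × Fin (d + 1) => blockOf (L ^ k) (MP (paramsOf d L mT k hL')) i.1))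
      Yc
      (fun y y' => 2 * C * Real.exp (-(ρY * tdistT (MP (paramsOf d L mT k hL')) y y'))) :=
    hmono (A := C * (1 - (C * r + ((d : ℝ) + 1) * (C₂ * r + C * r)) * cr)⁻¹) (mul_nonneg hC.le hq₂0) (by nlinarith [mul_le_mul_of_nonneg_left hq₂2 hC.le]) le_rfl hY0
  have hYρ := hmono (A := 2 * C) (by positivity) le_rfl hρle hY
  have hYstep : ∀ ι : Fin (d + 1), HasMaj (BlockNorm.ofBlocks (unitTorusGeo L k (MP (paramsOf d L mT k hL'))) (fun i : Tor (fine (L ^ k) (MP (paramsOf d L mT k hL'))) × Fin (d + 1) => blockOf (L ^ k) (MP (paramsOf d L mT k hL')) i.1))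
      (BlockNorm.ofBlocks (unitTorusGeo L k (MP (paramsOf d L mT k hL'))) (fun i : Tor (fine (L ^ k) (MP (paramsOf d L mT k hL'))) × Fin (d + 1) => blockOf (L ^ k) (MP (paramsOf d L mT k hL')) i.1))
      ((pull ⇑(bshiftEquiv (MP (paramsOf d L mT k hL')) (L ^ k) ι) - LinearMap.id) ∘ₗ
        Yc)
      (fun y y' => KH * θ * Real.exp (-(ρ * tdistT (MP (paramsOf d L mT k hL')) y y'))) := by
    intro ι
    have h := hasMaj_fstep_dressedDiv (MP (paramsOf d L mT k hL')) k (L ^ k) hσ.le hrow hρ.le hρρY hρYδ hC.le (by positivity : 0 ≤ C₆ * θ) hr hr (by positivity : (0 : ℝ) ≤ 2 * C) κ ι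
      hG hGD (hSstep ι) hcb hab hbq hq hY
    refine hmono ?_ ?_ le_rfl h
    · positivity
    have t1 : (((L ^ k : ℕ) : ℝ))⁻¹ * C * ((r + ((d : ℝ) + 1) * r) * (2 * C)) * cr ≤ C * (((d : ℝ) + 2) * (2 * C)) * cr * θ := by
      have h0 : r + ((d : ℝ) + 1) * r ≤ (d : ℝ) + 2 := by nlinarith
      have hx : (r + ((d : ℝ) + 1) * r) * (2 * C) ≤ ((d : ℝ) + 2) * (2 * C) := mul_le_mul_of_nonneg_right h0 (by positivity)
      calc (((L ^ k : ℕ) : ℝ))⁻¹ * C * ((r + ((d : ℝ) + 1) * r) * (2 * C)) * cr = (C * cr) * ((((L ^ k : ℕ) : ℝ))⁻¹ * ((r + ((d : ℝ) + 1) * r) * (2 * C))) := by ring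
        _ ≤ (C * cr) * (θ * (((d : ℝ) + 2) * (2 * C))) := mul_le_mul_of_nonneg_left (mul_le_mul hinv hx (by positivity) hθ) (by positivity)
        _ = C * (((d : ℝ) + 2) * (2 * C)) * cr * θ := by ring
    have t2 : C₆ * θ * (r * (2 * C * Real.exp ρY)) * cr ≤ C₆ * (1 * (2 * C * E)) * cr * θ := by
      have hx : r * (2 * C * Real.exp ρY) ≤ 1 * (2 * C * E) := mul_le_mul_of_nonneg_right hr1 (by positivity)
      calc C₆ * θ * (r * (2 * C * Real.exp ρY)) * cr = (C₆ * θ * cr) * (r * (2 * C * Real.exp ρY)) := by ring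
        _ ≤ (C₆ * θ * cr) * (1 * (2 * C * E)) := mul_le_mul_of_nonneg_left hx (by positivity)
        _ = C₆ * (1 * (2 * C * E)) * cr * θ := by ring
    rw [hKH_def]
    have hd1 : (0 : ℝ) ≤ (d : ℝ) + 1 := by positivity
    have t3 := mul_le_mul_of_nonneg_left t2 hd1
    linarith [t1, t3]
  have hYD : ∀ μ : Fin (d + 1), HasMaj (BlockNorm.ofBlocks (unitTorusGeo L k (MP (paramsOf d L mT k hL'))) (fun i : Tor (fine (L ^ k) (MP (paramsOf d L mT k hL'))) × Fin (d + 1) => blockOf (L ^ k) (MP (paramsOf d L mT k hL')) i.1))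
      (BlockNorm.ofBlocks (unitTorusGeo L k (MP (paramsOf d L mT k hL'))) (fun i : Tor (fine (L ^ k) (MP (paramsOf d L mT k hL'))) × Fin (d + 1) => blockOf (L ^ k) (MP (paramsOf d L mT k hL')) i.1))
      (symbOp (MP (paramsOf d L mT k hL')) (L ^ k) (sD (MP (paramsOf d L mT k hL')) (L ^ k) μ ((L ^ k : ℕ) : ℝ)) ∘ₗ
        Yc)
      (fun y y' => ((L ^ k : ℕ) : ℝ) * (KH * θ) * Real.exp (-(ρ * tdistT (MP (paramsOf d L mT k hL')) y y'))) := by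
    intro μ
    have e := pull_bshift_sub_id_comp_eq (MP (paramsOf d L mT k hL')) (L ^ k) μ Yc
    have e2 : symbOp (MP (paramsOf d L mT k hL')) (L ^ k) (sD (MP (paramsOf d L mT k hL')) (L ^ k) μ ((L ^ k : ℕ) : ℝ)) ∘ₗ Yc = ((L ^ k : ℕ) : ℝ) • ((pull ⇑(bshiftEquiv (MP (paramsOf d L mT k hL')) (L ^ k) μ) - LinearMap.id) ∘ₗ Yc) := by
      rw [e, smul_smul, mul_inv_cancel₀ hkpos.ne', one_smul]
    have hsm := (hasMaj_smul_ofBlocks (g := unitTorusGeo L k (MP (paramsOf d L mT k hL'))) (fun i : Tor (fine (L ^ k) (MP (paramsOf d L mT k hL'))) × Fin (d + 1) => blockOf (L ^ k) (MP (paramsOf d L mT k hL')) i.1)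
      (fun _ _ => by positivity) (((L ^ k : ℕ) : ℝ)) (hYstep μ)).mono (K' := fun y y' => ((L ^ k : ℕ) : ℝ) * (KH * θ) * Real.exp (-(ρ * tdistT (MP (paramsOf d L mT k hL')) y y')))
      fun y y' => le_of_eq (by rw [abs_of_nonneg hkpos.le]; ring)
    exact hsm.congr fun v => LinearMap.congr_fun e2.symm v
  have hJb : ∀ μ : Fin (d + 1), HasMaj (BlockNorm.ofBlocks (unitTorusGeo L k (MP (paramsOf d L mT k hL'))) (blkFine L k (MP (paramsOf d L mT k hL'))))
      (BlockNorm.ofBlocks (unitTorusGeo L k (MP (paramsOf d L mT k hL'))) (fun i : Tor (fine (L ^ m * L ^ k) (MP (paramsOf d L mT k hL'))) × Fin (d + 1) => blockOf (L ^ m * L ^ k) (MP (paramsOf d L mT k hL')) i.1))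
      (gOp (MP (paramsOf d L mT k hL')) (L ^ m * L ^ k) a ∘ₗ (idef (pull (kingPrV L k m (MP (paramsOf d L mT k hL')))) (pull (kingPrV L k m (MP (paramsOf d L mT k hL'))))
          (mulOp fun z : Tor (fine (L ^ m * L ^ k) (MP (paramsOf d L mT k hL'))) × Fin (d + 1) =>
            ((L ^ m * L ^ k : ℕ) : ℝ) * (a' μ z - a' μ (z.1 - unitVec (fine (L ^ m * L ^ k) (MP (paramsOf d L mT k hL'))) μ, z.2)))
          (mulOp fun z : Tor (fine (L ^ k) (MP (paramsOf d L mT k hL'))) × Fin (d + 1) => ((L ^ k : ℕ) : ℝ) * (blockAvg (kingPrV L k m (MP (paramsOf d L mT k hL'))) (a' μ) z -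
            blockAvg (kingPrV L k m (MP (paramsOf d L mT k hL'))) (a' μ) (z.1 - unitVec (fine (L ^ k) (MP (paramsOf d L mT k hL'))) μ, z.2))) ∘ₗ
        Yc))
      (fun y y' => Kb * θ * Real.exp (-(ρ * tdistT (MP (paramsOf d L mT k hL')) y y'))) := by
    intro μ
    have h := hasMaj_junk_bRow (MP (paramsOf d L mT k hL')) k m hrow hρ.le hρδ hC.le hC.le hr hoadef (by positivity : (0 : ℝ) ≤ 2 * C) (by positivity : 0 ≤ ((L ^ k : ℕ) : ℝ) * (KH * θ)) μ
      hG' (hG'div μ) (hb' μ) (hfa μ) hYρ (hYD μ)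
    refine hmono ?_ ?_ le_rfl h
    · positivity
    have hEρ : Real.exp ρ ≤ E := Real.exp_le_exp.mpr hρle
    have hEρ0 : 0 ≤ Real.exp ρ := (Real.exp_pos _).le
    have u1 : C * r * ((((L ^ k : ℕ) : ℝ))⁻¹ * (((L ^ k : ℕ) : ℝ) * (KH * θ))) ≤ C * 1 * KH * θ := by
      rw [← mul_assoc (((L ^ k : ℕ) : ℝ))⁻¹, inv_mul_cancel₀ hkpos.ne', one_mul]
      calc C * r * (KH * θ) = (C * KH * θ) * r := by ring
        _ ≤ (C * KH * θ) * 1 := mul_le_mul_of_nonneg_left hr1 (by positivity)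
        _ = C * 1 * KH * θ := by ring
    have u2 : (((L ^ k : ℕ) : ℝ))⁻¹ * (C * (r * (2 * C * Real.exp ρ) * Real.exp ρ)) ≤ C * (1 * (2 * C * E) * E) * θ := by
      have hx : r * (2 * C * Real.exp ρ) * Real.exp ρ ≤ 1 * (2 * C * E) * E :=
        mul_le_mul (mul_le_mul hr1 (mul_le_mul_of_nonneg_left hEρ (by positivity)) (by positivity) zero_le_one) hEρ hEρ0 (by positivity)
      calc (((L ^ k : ℕ) : ℝ))⁻¹ * (C * (r * (2 * C * Real.exp ρ) * Real.exp ρ)) = C * ((r * (2 * C * Real.exp ρ) * Real.exp ρ) * (((L ^ k : ℕ) : ℝ))⁻¹) := by ring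
        _ ≤ C * ((1 * (2 * C * E) * E) * θ) := mul_le_mul_of_nonneg_left (mul_le_mul hx hinv (by positivity) (by positivity)) hC.le
        _ = C * (1 * (2 * C * E) * E) * θ := by ring
    have u3 : C * (((2 * ((d + 1) * (L ^ m - 1)) : ℕ) : ℝ) * (r / ((L ^ m * L ^ k : ℕ) : ℝ))) * (((L ^ k : ℕ) : ℝ) * (KH * θ)) ≤ C * (2 * ((d : ℝ) + 1)) * KH * θ := by
      calc C * (((2 * ((d + 1) * (L ^ m - 1)) : ℕ) : ℝ) * (r / ((L ^ m * L ^ k : ℕ) : ℝ))) * (((L ^ k : ℕ) : ℝ) * (KH * θ)) =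
            C * (KH * θ) * (((2 * ((d + 1) * (L ^ m - 1)) : ℕ) : ℝ) * (r / ((L ^ m * L ^ k : ℕ) : ℝ)) * ((L ^ k : ℕ) : ℝ)) := by ring
        _ ≤ C * (KH * θ) * (2 * ((d : ℝ) + 1) * r) := mul_le_mul_of_nonneg_left hoan (by positivity)
        _ ≤ C * (KH * θ) * (2 * ((d : ℝ) + 1) * 1) := mul_le_mul_of_nonneg_left (mul_le_mul_of_nonneg_left hr1 (by positivity)) (by positivity)
        _ = C * (2 * ((d : ℝ) + 1)) * KH * θ := by ring
    have u4 : C * ((((2 * ((d + 1) * (L ^ m - 1)) : ℕ) : ℝ) * (r / ((L ^ m * L ^ k : ℕ) : ℝ))) * (2 * C * Real.exp ρ) * Real.exp ρ) ≤ C * (2 * ((d : ℝ) + 1) * (2 * C * E) * E) * θ := by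
      have hx : (((2 * ((d + 1) * (L ^ m - 1)) : ℕ) : ℝ) * (r / ((L ^ m * L ^ k : ℕ) : ℝ))) * (2 * C * Real.exp ρ) * Real.exp ρ ≤ (2 * ((d : ℝ) + 1) * θ) * (2 * C * E) * E :=
        mul_le_mul (mul_le_mul hoaθ (mul_le_mul_of_nonneg_left hEρ (by positivity)) (by positivity) (by positivity)) hEρ hEρ0 (by positivity)
      calc _ ≤ C * ((2 * ((d : ℝ) + 1) * θ) * (2 * C * E) * E) := mul_le_mul_of_nonneg_left hx hC.le
        _ = C * (2 * ((d : ℝ) + 1) * (2 * C * E) * E) * θ := by ring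
    rw [hKb_def]
    have hsum := add_le_add (add_le_add (add_le_add u1 u2) u3) u4
    calc (C * r * ((((L ^ k : ℕ) : ℝ))⁻¹ * (((L ^ k : ℕ) : ℝ) * (KH * θ))) + (((L ^ k : ℕ) : ℝ))⁻¹ * (C * (r * (2 * C * Real.exp ρ) * Real.exp ρ)) +
          C * (((2 * ((d + 1) * (L ^ m - 1)) : ℕ) : ℝ) * (r / ((L ^ m * L ^ k : ℕ) : ℝ))) * (((L ^ k : ℕ) : ℝ) * (KH * θ)) +
          C * ((((2 * ((d + 1) * (L ^ m - 1)) : ℕ) : ℝ) * (r / ((L ^ m * L ^ k : ℕ) : ℝ))) * (2 * C * Real.exp ρ) * Real.exp ρ)) * cr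
        ≤ (C * 1 * KH * θ + C * (1 * (2 * C * E) * E) * θ + C * (2 * ((d : ℝ) + 1)) * KH * θ + C * (2 * ((d : ℝ) + 1) * (2 * C * E) * E) * θ) * cr := mul_le_mul_of_nonneg_right hsum hcr
      _ = (C * 1 * KH + C * (1 * (2 * C * E) * E) + C * (2 * ((d : ℝ) + 1)) * KH + C * (2 * ((d : ℝ) + 1) * (2 * C * E) * E)) * cr * θ := by ring
  have hGc0 := hasMaj_comp_idef_mulOp_blockAvg_of_divAdj (MP (paramsOf d L mT k hL')) k m (K := fun y y' => C * Real.exp (-(δm * tdistT (MP (paramsOf d L mT k hL')) y y'))) (fun _ _ => mul_nonneg hC.le (Real.exp_nonneg _)) hr hc' hG'div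
  have hGc : HasMaj (BlockNorm.ofBlocks (unitTorusGeo L k (MP (paramsOf d L mT k hL'))) (blkFine L k (MP (paramsOf d L mT k hL'))))
      (BlockNorm.ofBlocks (unitTorusGeo L k (MP (paramsOf d L mT k hL'))) (fun i : Tor (fine (L ^ m * L ^ k) (MP (paramsOf d L mT k hL'))) × Fin (d + 1) => blockOf (L ^ m * L ^ k) (MP (paramsOf d L mT k hL')) i.1))
      (gOp (MP (paramsOf d L mT k hL')) (L ^ m * L ^ k) a ∘ₗ idef (pull (kingPrV L k m (MP (paramsOf d L mT k hL')))) (pull (kingPrV L k m (MP (paramsOf d L mT k hL')))) (mulOp c') (mulOp (blockAvg (kingPrV L k m (MP (paramsOf d L mT k hL'))) c')))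
      (fun y y' => Kc * θ * Real.exp (-(δm * tdistT (MP (paramsOf d L mT k hL')) y y'))) := by
    refine hGc0.mono fun y y' => ?_
    have hE' := Real.exp_nonneg (-(δm * tdistT (MP (paramsOf d L mT k hL')) y y'))
    have hx : 2 * (d + 1) * r * (((L ^ k : ℕ) : ℝ))⁻¹ * C ≤ Kc * θ := by
      rw [hKc_def]
      calc 2 * (d + 1) * r * (((L ^ k : ℕ) : ℝ))⁻¹ * C = (2 * ((d : ℝ) + 1) * C) * (r * (((L ^ k : ℕ) : ℝ))⁻¹) := by push_cast; ring
        _ ≤ (2 * ((d : ℝ) + 1) * C) * (1 * θ) := mul_le_mul_of_nonneg_left (mul_le_mul hr1 hinv (by positivity) zero_le_one) (by positivity)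
        _ = 2 * ((d : ℝ) + 1) * C * θ := by ring
    calc 2 * (d + 1) * r * (((L ^ k : ℕ) : ℝ))⁻¹ * (C * Real.exp (-(δm * tdistT (MP (paramsOf d L mT k hL')) y y'))) = (2 * (d + 1) * r * (((L ^ k : ℕ) : ℝ))⁻¹ * C) * Real.exp (-(δm * tdistT (MP (paramsOf d L mT k hL')) y y')) := by ring
      _ ≤ Kc * θ * Real.exp (-(δm * tdistT (MP (paramsOf d L mT k hL')) y y')) := mul_le_mul_of_nonneg_right hx hE'
  have key := hasMaj_idef_dressedDiv_of_letters (MP (paramsOf d L mT k hL')) k m hσ.le hcr hrow (ρ := ρ) (δ := δm) hρ.le hρδ hC.le hC.le hC₂ (by positivity : 0 ≤ D₁ * θ) (by positivity : 0 ≤ D₂ * θ) hr hr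
    hoadef (by positivity : (0 : ℝ) ≤ 2 * C) (by positivity : 0 ≤ KH * θ) (by positivity : 0 ≤ Kc * θ) (by positivity : 0 ≤ Kb * θ) κ
    hG hGD hG' hG'D hG'grad hG'div hDG hDS hc' ha' hb' hbq hfa hYρ hYstep hGc hJb hq hqK
  have hbd := dressedDiv_const_bound (t := (d : ℝ)) hD₁.le hD₂.le hC.le hcr hKc hKb hKH hθ hr hr1 hoadef hoaθ hE (Nat.cast_nonneg d) hq₂0 hq₂2
  refine key.mono fun y y' => ?_
  have hE' := Real.exp_nonneg (-(ρ * tdistT (MP (paramsOf d L mT k hL')) y y'))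
  have hEE : Real.exp ρ ≤ E := Real.exp_le_exp.mpr hρle
  have hA1 : (D₂ * θ + D₁ * θ * ((r + (d + 1) * r) * (2 * C)) * cr + Kc * θ * (2 * C) * cr + (d + 1) * (Kb * θ) +
        (d + 1) * (D₂ * θ * (r * (2 * C * Real.exp ρ)) * cr + C * (((2 * ((d + 1) * (L ^ m - 1)) : ℕ) : ℝ) * (r / ((L ^ m * L ^ k : ℕ) : ℝ))) * (2 * C * Real.exp ρ) * cr +
          C * r * (KH * θ) * cr)) ≤
      (D₂ * θ + D₁ * θ * ((r + ((d : ℝ) + 1) * r) * (2 * C)) * cr + Kc * θ * (2 * C) * cr + ((d : ℝ) + 1) * (Kb * θ) +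
        ((d : ℝ) + 1) * (D₂ * θ * (r * (2 * C * E)) * cr + C * (((2 * ((d + 1) * (L ^ m - 1)) : ℕ) : ℝ) * (r / ((L ^ m * L ^ k : ℕ) : ℝ))) * (2 * C * E) * cr +
          C * r * (KH * θ) * cr)) := by
    have v1 : D₂ * θ * (r * (2 * C * Real.exp ρ)) * cr ≤ D₂ * θ * (r * (2 * C * E)) * cr :=
      mul_le_mul_of_nonneg_right (mul_le_mul_of_nonneg_left (mul_le_mul_of_nonneg_left (mul_le_mul_of_nonneg_left hEE (by positivity)) hr) (by positivity)) hcr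
    have v2 : C * (((2 * ((d + 1) * (L ^ m - 1)) : ℕ) : ℝ) * (r / ((L ^ m * L ^ k : ℕ) : ℝ))) * (2 * C * Real.exp ρ) * cr ≤
        C * (((2 * ((d + 1) * (L ^ m - 1)) : ℕ) : ℝ) * (r / ((L ^ m * L ^ k : ℕ) : ℝ))) * (2 * C * E) * cr :=
      mul_le_mul_of_nonneg_right (mul_le_mul_of_nonneg_left (mul_le_mul_of_nonneg_left hEE (by positivity)) (by positivity)) hcr
    have hd0 : (0 : ℝ) ≤ (d : ℝ) + 1 := by positivity
    have v3 := mul_le_mul_of_nonneg_left (add_le_add v1 v2) hd0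
    linarith [v3]
  have hpos : 0 ≤ (1 - (C * r + ((d : ℝ) + 1) * (C₂ * r + C * r)) * cr)⁻¹ := hq₂0
  calc _ ≤ (D₂ * θ + D₁ * θ * ((r + ((d : ℝ) + 1) * r) * (2 * C)) * cr + Kc * θ * (2 * C) * cr + ((d : ℝ) + 1) * (Kb * θ) +
        ((d : ℝ) + 1) * (D₂ * θ * (r * (2 * C * E)) * cr + C * (((2 * ((d + 1) * (L ^ m - 1)) : ℕ) : ℝ) * (r / ((L ^ m * L ^ k : ℕ) : ℝ))) * (2 * C * E) * cr +
          C * r * (KH * θ) * cr)) * (1 - (C * r + ((d : ℝ) + 1) * (C₂ * r + C * r)) * cr)⁻¹ * Real.exp (-(ρ * tdistT (MP (paramsOf d L mT k hL')) y y')) :=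
        mul_le_mul_of_nonneg_right (mul_le_mul_of_nonneg_right hA1 hpos) hE'
    _ ≤ B * θ * Real.exp (-(ρ * tdistT (MP (paramsOf d L mT k hL')) y y')) := by
        rw [hB_def]
        exact mul_le_mul_of_nonneg_right hbd hE'

end Summit.QuantumFields.YangMills.BalabanUVNodes.N15.TwoGrid

end
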